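import Summits.NavierStokesRegularity.NavierStokesRegularity.Theses.RellichScar
import Summits.NavierStokesRegularity.NavierStokesRegularity.Theorems.ScarRigidity.Negative.LogicAndLoadBearing
import Literature.Analysis.FluidPDE.TypeIAncientMild
import Literature.Analysis.FluidPDE.ParasiticSlabFlow
import Literature.Analysis.FluidPDE.SpaceTimeCalculus
import Literature.Analysis.FluidPDE.NewtonPotential
import Mathlib.MeasureTheory.Integral.Prod
import Summits.NavierStokesRegularity.NavierStokesRegularity.Theorems.RellichScarScarRigidityCoulombBounds
import Summits.NavierStokesRegularity.NavierStokesRegularity.Theorems.RellichScarScarRigidityLogConvexityL2Energy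
import HarnessLib

/-!
# `ScarRigidity` — line `finite-energy-log-convexity`, stub `stub_coulombEnergyPackage`:
# the Coulomb energy of an apex density is differentiable in time (crux stmt-NavierStokesRegularity-11717)

Helper file 6 of S4-E (`stub_coulombEnergyPackage`). The Coulomb (`Ḣ⁻¹`) energy of a time-dependent
field `w` is the double integral `𝒟(t) = ∫∫ Γ(x - y) ⟪w(t,x), w(t,y)⟫ dx dy`
(`Γ = newtonKernel = -1/(4π|z|)`; the energy of the package is `N = -𝒟 ≥ 0`). For a jointly smooth
`w` on the open slab `t < 0` with the apex majorants `‖w(s,y)‖ ≤ K(-s)/(‖y‖+√(-s))³`,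
`‖∂ₜw(s,y)‖ ≤ L/(‖y‖+√(-s))³`:

* `integrable_newtonKernel_weight_prod` — the majorant `|Γ(x-y)| ρ(x)⁻³ ρ(y)⁻³` is integrable on
  `ℝ³ × ℝ³` (Tonelli; the inner integral is `≲ ‖x‖^{-3/4}` by the decay file);
* `integral_newtonKernel_inner_prod`, `integral_inner_newtonPotential_symm` — Fubini:
  `∫∫ Γ(x-y)⟪f(x), g(y)⟫ = ∫ ⟪f, Γ ⋆ g⟫ = ∫ ⟪Γ ⋆ f, g⟫` (**symmetry of the kernel**);
* `hasDerivAt_coulomb_double_integral` — **`𝒟'(t) = ∫∫ Γ(x-y)(⟪∂ₜw(x), w(y)⟫ + ⟪w(x), ∂ₜw(y)⟫)`**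
  (dominated differentiation on the product space over the window `(2t, t/2)`);
* `hasDerivAt_integral_inner_newtonPotential` — **`d/dt ∫ ⟪w, Γ ⋆ w⟫ = 2 ∫ ⟪∂ₜw, Γ ⋆ w⟫`**, the form
  consumed by the package.
-/

noncomputable section

open Set Filter Function MeasureTheory Metric TopologicalSpace
open scoped Topology ENNReal NNReal InnerProductSpace RealInnerProductSpace
open Literature.Analysis.FluidPDE
open Summit.NavierStokesRegularity.NavierStokesRegularity.Theses.RellichScar
open Summit.NavierStokesRegularity.NavierStokesRegularity.Theorems.ScarRigidity.Negative

set_option linter.dupNamespace false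

namespace Summit.NavierStokesRegularity.NavierStokesRegularity.Theorems.RellichScarScarRigidity

open Real

/-! ## The majorant is integrable on the product space -/

/-- The inner integral of the majorant: `∫ |Γ(x-y)| ρ(y)⁻³ dy ≤ K a^{-1/4} ‖x‖^{-3/4}` for `x ≠ 0`,
with integrability (Riesz composition, exponents `(11/4, 1)`). [folklore] -/
theorem exists_integral_abs_newtonKernel_mul_weight_le :
    ∃ K : ℝ, 0 ≤ K ∧ ∀ (a : ℝ), 0 < a → ∀ x : EuclideanSpace ℝ (Fin 3), x ≠ 0 →
      Integrable (fun y => |newtonKernel (x - y)| * ((‖y‖ + a) ^ 3)⁻¹) volume ∧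
        ∫ y, |newtonKernel (x - y)| * ((‖y‖ + a) ^ 3)⁻¹ ≤ K * a ^ (-(1 / 4 : ℝ)) * ‖x‖ ^ (-(3 / 4 : ℝ)) := by
  obtain ⟨K, hK, hR⟩ := exists_integral_rpow_mul_rpow_le (α := 11 / 4) (β := 1) (by norm_num)
    (by norm_num) (by norm_num) (by norm_num) (by norm_num)
  refine ⟨(4 * π)⁻¹ * K, by positivity, fun a ha x hx => ?_⟩
  obtain ⟨hint, hle⟩ := hR x hx
  rw [show (3 : ℝ) - 11 / 4 - 1 = -(3 / 4 : ℝ) by norm_num] at hle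
  have hθ : a ^ ((11 / 4 : ℝ) - 3) = a ^ (-(1 / 4 : ℝ)) := by norm_num
  have hpt : ∀ᵐ y ∂(volume : Measure (EuclideanSpace ℝ (Fin 3))),
      ‖|newtonKernel (x - y)| * ((‖y‖ + a) ^ 3)⁻¹‖ ≤
        (4 * π)⁻¹ * a ^ (-(1 / 4 : ℝ)) * (‖x - y‖ ^ (-(1 : ℝ)) * ‖y‖ ^ (-(11 / 4 : ℝ))) := by
    filter_upwards [ae_ne_point 0] with y hy
    rw [Real.norm_of_nonneg (by positivity), abs_newtonKernel, Real.rpow_neg_one]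
    have h2 : ((‖y‖ + a) ^ 3)⁻¹ ≤ a ^ (-(1 / 4 : ℝ)) * ‖y‖ ^ (-(11 / 4 : ℝ)) := by
      rw [← hθ]; exact inv_norm_add_cube_le_rpow ha (by norm_num) (by norm_num) hy
    calc (4 * π * ‖x - y‖)⁻¹ * ((‖y‖ + a) ^ 3)⁻¹
        ≤ (4 * π * ‖x - y‖)⁻¹ * (a ^ (-(1 / 4 : ℝ)) * ‖y‖ ^ (-(11 / 4 : ℝ))) :=
          mul_le_mul_of_nonneg_left h2 (by positivity)
      _ = (4 * π)⁻¹ * a ^ (-(1 / 4 : ℝ)) * (‖x - y‖⁻¹ * ‖y‖ ^ (-(11 / 4 : ℝ))) := by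
          rw [mul_inv]; ring
  have hmeas : AEStronglyMeasurable (fun y => |newtonKernel (x - y)| * ((‖y‖ + a) ^ 3)⁻¹) volume :=
    ((measurable_newtonKernel.comp (measurable_const.sub measurable_id)).abs.mul
      ((measurable_norm.add_const a).pow_const 3).inv).aestronglyMeasurable
  have hint' : Integrable (fun y => |newtonKernel (x - y)| * ((‖y‖ + a) ^ 3)⁻¹) volume :=
    (hint.const_mul _).mono' hmeas hpt
  refine ⟨hint', ?_⟩
  calc ∫ y, |newtonKernel (x - y)| * ((‖y‖ + a) ^ 3)⁻¹
      ≤ ∫ y, (4 * π)⁻¹ * a ^ (-(1 / 4 : ℝ)) * (‖x - y‖ ^ (-(1 : ℝ)) * ‖y‖ ^ (-(11 / 4 : ℝ))) :=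
        integral_mono_of_nonneg (Eventually.of_forall fun y => by positivity) (hint.const_mul _)
          (hpt.mono fun y hy => (le_abs_self _).trans ((Real.norm_eq_abs _).symm.le.trans hy))
    _ ≤ (4 * π)⁻¹ * a ^ (-(1 / 4 : ℝ)) * (K * ‖x‖ ^ (-(3 / 4 : ℝ))) := by
        rw [integral_const_mul]; exact mul_le_mul_of_nonneg_left hle (by positivity)
    _ = (4 * π)⁻¹ * K * a ^ (-(1 / 4 : ℝ)) * ‖x‖ ^ (-(3 / 4 : ℝ)) := by ring

/-- **The Coulomb majorant is integrable on `ℝ³ × ℝ³`**: `(x, y) ↦ |Γ(x-y)| ρ(x)⁻³ ρ(y)⁻³ ∈ L¹`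
for `a > 0` (Tonelli: the inner integral is `≲ ‖x‖^{-3/4}`, and `ρ⁻³ ‖x‖^{-3/4} ∈ L¹`). [folklore] -/
theorem integrable_newtonKernel_weight_prod {a : ℝ} (ha : 0 < a) :
    Integrable (fun p : (EuclideanSpace ℝ (Fin 3)) × (EuclideanSpace ℝ (Fin 3)) =>
      |newtonKernel (p.1 - p.2)| * (((‖p.1‖ + a) ^ 3)⁻¹ * ((‖p.2‖ + a) ^ 3)⁻¹))
      ((volume : Measure (EuclideanSpace ℝ (Fin 3))).prod volume) := by
  obtain ⟨K, hK, hin⟩ := exists_integral_abs_newtonKernel_mul_weight_le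
  have hmeas : AEStronglyMeasurable (fun p : (EuclideanSpace ℝ (Fin 3)) × (EuclideanSpace ℝ (Fin 3)) =>
      |newtonKernel (p.1 - p.2)| * (((‖p.1‖ + a) ^ 3)⁻¹ * ((‖p.2‖ + a) ^ 3)⁻¹))
      ((volume : Measure (EuclideanSpace ℝ (Fin 3))).prod volume) :=
    ((measurable_newtonKernel.comp (measurable_fst.sub measurable_snd)).abs.mul
      (((measurable_fst.norm.add_const a).pow_const 3).inv.mul
        ((measurable_snd.norm.add_const a).pow_const 3).inv)).aestronglyMeasurable
  rw [integrable_prod_iff hmeas]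
  constructor
  · filter_upwards [ae_ne_point 0] with x hx
    have h := ((hin a ha x hx).1).const_mul (((‖x‖ + a) ^ 3)⁻¹)
    refine h.congr (Eventually.of_forall fun y => ?_)
    simp only; ring
  · have hmaj := (integrable_inv_norm_add_cube_mul_rpow ha (by norm_num : (0 : ℝ) < 3 / 4)
      (by norm_num)).const_mul (K * a ^ (-(1 / 4 : ℝ)))
    refine hmaj.mono' hmeas.norm.integral_prod_right' ?_
    filter_upwards [ae_ne_point 0] with x hx
    obtain ⟨hi, hle⟩ := hin a ha x hx
    rw [Real.norm_of_nonneg (integral_nonneg fun y => norm_nonneg _)]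
    have e : ∀ y : EuclideanSpace ℝ (Fin 3),
        ‖|newtonKernel (x - y)| * (((‖x‖ + a) ^ 3)⁻¹ * ((‖y‖ + a) ^ 3)⁻¹)‖ =
          ((‖x‖ + a) ^ 3)⁻¹ * (|newtonKernel (x - y)| * ((‖y‖ + a) ^ 3)⁻¹) := fun y => by
      rw [Real.norm_of_nonneg (by positivity)]; ring
    simp_rw [e]
    rw [integral_const_mul]
    calc ((‖x‖ + a) ^ 3)⁻¹ * ∫ y, |newtonKernel (x - y)| * ((‖y‖ + a) ^ 3)⁻¹
        ≤ ((‖x‖ + a) ^ 3)⁻¹ * (K * a ^ (-(1 / 4 : ℝ)) * ‖x‖ ^ (-(3 / 4 : ℝ))) :=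
          mul_le_mul_of_nonneg_left hle (by positivity)
      _ = K * a ^ (-(1 / 4 : ℝ)) * (((‖x‖ + a) ^ 3)⁻¹ * ‖x‖ ^ (-(3 / 4 : ℝ))) := by ring

/-! ## Fubini: `∫∫ Γ(x-y)⟪f(x), g(y)⟫ = ∫ ⟪f, Γ ⋆ g⟫ = ∫ ⟪Γ ⋆ f, g⟫` -/

/-- The Coulomb pairing of two continuous apex-decaying fields is absolutely convergent on the
product space. [folklore] -/
theorem integrable_newtonKernel_inner_prod
    {f g : (EuclideanSpace ℝ (Fin 3)) → (EuclideanSpace ℝ (Fin 3))} (hf : Continuous f)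
    (hg : Continuous g) {a A B : ℝ} (ha : 0 < a)
    (hfb : ∀ x, ‖f x‖ ≤ A * ((‖x‖ + a) ^ 3)⁻¹) (hgb : ∀ y, ‖g y‖ ≤ B * ((‖y‖ + a) ^ 3)⁻¹) :
    Integrable (fun p : (EuclideanSpace ℝ (Fin 3)) × (EuclideanSpace ℝ (Fin 3)) =>
      newtonKernel (p.1 - p.2) * ⟪f p.1, g p.2⟫)
      ((volume : Measure (EuclideanSpace ℝ (Fin 3))).prod volume) := by
  have hA : 0 ≤ A := by
    have := (norm_nonneg _).trans (hfb 0)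
    have hpos : (0 : ℝ) < ((‖(0 : EuclideanSpace ℝ (Fin 3))‖ + a) ^ 3)⁻¹ := by positivity
    nlinarith
  refine ((integrable_newtonKernel_weight_prod ha).const_mul (A * B)).mono'
    ((measurable_newtonKernel.comp (measurable_fst.sub measurable_snd)).aestronglyMeasurable.mul
      ((hf.comp continuous_fst).inner (hg.comp continuous_snd)).aestronglyMeasurable)
    (Eventually.of_forall fun p => ?_)
  rw [norm_mul, Real.norm_eq_abs]
  calc |newtonKernel (p.1 - p.2)| * ‖⟪f p.1, g p.2⟫‖
      ≤ |newtonKernel (p.1 - p.2)| * (‖f p.1‖ * ‖g p.2‖) :=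
        mul_le_mul_of_nonneg_left (norm_inner_le_norm _ _) (abs_nonneg _)
    _ ≤ |newtonKernel (p.1 - p.2)| * ((A * ((‖p.1‖ + a) ^ 3)⁻¹) * (B * ((‖p.2‖ + a) ^ 3)⁻¹)) :=
        mul_le_mul_of_nonneg_left (mul_le_mul (hfb _) (hgb _) (norm_nonneg _) (by positivity))
          (abs_nonneg _)
    _ = A * B * (|newtonKernel (p.1 - p.2)| * (((‖p.1‖ + a) ^ 3)⁻¹ * ((‖p.2‖ + a) ^ 3)⁻¹)) := by
        ring

/-- **Fubini for the Coulomb pairing**: `∫∫ Γ(x-y)⟪f(x), g(y)⟫ dx dy = ∫ ⟪f(x), ∫ Γ(x-y) g(y) dy⟫ dx`.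
[folklore] -/
theorem integral_newtonKernel_inner_prod
    {f g : (EuclideanSpace ℝ (Fin 3)) → (EuclideanSpace ℝ (Fin 3))} (hf : Continuous f)
    (hg : Continuous g) {a A B : ℝ} (ha : 0 < a)
    (hfb : ∀ x, ‖f x‖ ≤ A * ((‖x‖ + a) ^ 3)⁻¹) (hgb : ∀ y, ‖g y‖ ≤ B * ((‖y‖ + a) ^ 3)⁻¹) :
    ∫ p : (EuclideanSpace ℝ (Fin 3)) × (EuclideanSpace ℝ (Fin 3)),
        newtonKernel (p.1 - p.2) * ⟪f p.1, g p.2⟫ ∂((volume : Measure (EuclideanSpace ℝ (Fin 3))).prod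
          volume) =
      ∫ x, ⟪f x, ∫ y, newtonKernel (x - y) • g y⟫ := by
  have hB : 0 ≤ B := by
    have := (norm_nonneg _).trans (hgb 0)
    have hpos : (0 : ℝ) < ((‖(0 : EuclideanSpace ℝ (Fin 3))‖ + a) ^ 3)⁻¹ := by positivity
    nlinarith
  obtain ⟨K, hK, hin⟩ := exists_integral_abs_newtonKernel_mul_weight_le
  rw [integral_prod _ (integrable_newtonKernel_inner_prod hf hg ha hfb hgb)]
  refine integral_congr_ae ?_
  filter_upwards [ae_ne_point 0] with x hx
  -- `y ↦ Γ(x-y) g(y)` is integrable for `x ≠ 0`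
  have hgi : Integrable (fun y => newtonKernel (x - y) • g y) volume := by
    refine (((hin a ha x hx).1).const_mul B).mono'
      ((measurable_newtonKernel.comp (measurable_const.sub measurable_id)).aestronglyMeasurable.smul
        hg.aestronglyMeasurable) (Eventually.of_forall fun y => ?_)
    rw [norm_smul, Real.norm_eq_abs]
    calc |newtonKernel (x - y)| * ‖g y‖ ≤ |newtonKernel (x - y)| * (B * ((‖y‖ + a) ^ 3)⁻¹) :=
          mul_le_mul_of_nonneg_left (hgb y) (abs_nonneg _)
      _ = B * (|newtonKernel (x - y)| * ((‖y‖ + a) ^ 3)⁻¹) := by ring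
  rw [← integral_inner hgi]
  refine integral_congr_ae (Eventually.of_forall fun y => ?_)
  simp only [real_inner_smul_right]

/-- **Symmetry of the Newtonian kernel under Fubini**:
`∫ ⟪f(x), ∫ Γ(x-y) g(y) dy⟫ dx = ∫ ⟪∫ Γ(y-x) f(x) dx, g(y)⟫ dy` (`Γ(x-y) = Γ(y-x)`). [folklore] -/
theorem integral_inner_newtonPotential_symm
    {f g : (EuclideanSpace ℝ (Fin 3)) → (EuclideanSpace ℝ (Fin 3))} (hf : Continuous f)
    (hg : Continuous g) {a A B : ℝ} (ha : 0 < a)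
    (hfb : ∀ x, ‖f x‖ ≤ A * ((‖x‖ + a) ^ 3)⁻¹) (hgb : ∀ y, ‖g y‖ ≤ B * ((‖y‖ + a) ^ 3)⁻¹) :
    ∫ x, ⟪f x, ∫ y, newtonKernel (x - y) • g y⟫ =
      ∫ y, ⟪∫ x, newtonKernel (y - x) • f x, g y⟫ := by
  rw [← integral_newtonKernel_inner_prod hf hg ha hfb hgb, ← integral_prod_swap]
  have e : (fun p : (EuclideanSpace ℝ (Fin 3)) × (EuclideanSpace ℝ (Fin 3)) =>
      newtonKernel (p.swap.1 - p.swap.2) * ⟪f p.swap.1, g p.swap.2⟫) =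
      fun p => newtonKernel (p.1 - p.2) * ⟪g p.1, f p.2⟫ := by
    funext p
    simp only [Prod.fst_swap, Prod.snd_swap, real_inner_comm (g p.1)]
    rw [newtonKernel_eq, newtonKernel_eq, norm_sub_rev]
  rw [e, integral_newtonKernel_inner_prod hg hf ha hgb hfb]
  refine integral_congr_ae (Eventually.of_forall fun y => ?_)
  exact real_inner_comm _ _

/-! ## Differentiation of the double integral in time -/

/-- **The Coulomb double integral is differentiable in time.** For a jointly smooth `w` on `t < 0`
with `‖w(s,y)‖ ≤ K(-s)/(‖y‖+√(-s))³`, `‖∂ₜw(s,y)‖ ≤ L/(‖y‖+√(-s))³`, at every `t < 0`,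
`s ↦ ∫∫ Γ(x-y)⟪w(s,x), w(s,y)⟫` has derivative `∫∫ Γ(x-y)(⟪w(x), ∂ₜw(y)⟫ + ⟪∂ₜw(x), w(y)⟫)` (dominated
differentiation on `ℝ³ × ℝ³` over the window `(2t, t/2)`, dominant
`2|K|(-2t)|L| |Γ(x-y)| ρ(x)⁻³ρ(y)⁻³`, `ρ = ‖·‖ + √(-t/2)`). [folklore] -/
theorem hasDerivAt_coulomb_double_integral
    {w : ℝ → (EuclideanSpace ℝ (Fin 3)) → (EuclideanSpace ℝ (Fin 3))} {K L : ℝ}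
    (hsm : IsSmoothSpaceTimeOn (Iio (0 : ℝ)) w)
    (hwb : ∀ s < 0, ∀ y : EuclideanSpace ℝ (Fin 3), ‖w s y‖ ≤ K * (-s) / (‖y‖ + Real.sqrt (-s)) ^ 3)
    (hdb : ∀ s < 0, ∀ y : EuclideanSpace ℝ (Fin 3),
      ‖deriv (fun τ => w τ y) s‖ ≤ L / (‖y‖ + Real.sqrt (-s)) ^ 3)
    {t : ℝ} (ht : t < 0) :
    HasDerivAt (fun s => ∫ p, newtonKernel (p.1 - p.2) * ⟪w s p.1, w s p.2⟫
        ∂((volume : Measure (EuclideanSpace ℝ (Fin 3))).prod volume))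
      (∫ p, newtonKernel (p.1 - p.2) * (⟪w t p.1, deriv (fun τ => w τ p.2) t⟫ +
          ⟪deriv (fun τ => w τ p.1) t, w t p.2⟫)
        ∂((volume : Measure (EuclideanSpace ℝ (Fin 3))).prod volume)) t := by
  -- the window and the regularising length
  set c₀ : ℝ := Real.sqrt (-t / 2) with hc₀_def
  have hc₀ : 0 < c₀ := Real.sqrt_pos.2 (by linarith)
  have hwin : Ioo (2 * t) (t / 2) ∈ 𝓝 t := Ioo_mem_nhds (by linarith) (by linarith)
  have hneg : ∀ s ∈ Ioo (2 * t) (t / 2), s < 0 := fun s hs => by linarith [hs.2]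
  have hsqrt : ∀ s ∈ Ioo (2 * t) (t / 2), c₀ ≤ Real.sqrt (-s) := fun s hs =>
    Real.sqrt_le_sqrt (by linarith [hs.2])
  set dw : ℝ → (EuclideanSpace ℝ (Fin 3)) → (EuclideanSpace ℝ (Fin 3)) :=
    fun s x => deriv (fun τ => w τ x) s with hdw_def
  have hdsm : IsSmoothSpaceTimeOn (Iio (0 : ℝ)) dw := hsm.isSmoothSpaceTimeOn_deriv isOpen_Iio
  -- uniform bounds on the window
  set Aw : ℝ := |K| * (-(2 * t)) with hAw
  have hAw0 : 0 ≤ Aw := mul_nonneg (abs_nonneg _) (by linarith)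
  have hwb' : ∀ s ∈ Ioo (2 * t) (t / 2), ∀ y : EuclideanSpace ℝ (Fin 3),
      ‖w s y‖ ≤ Aw * ((‖y‖ + c₀) ^ 3)⁻¹ := by
    intro s hs y
    have hyc : 0 < ‖y‖ + c₀ := by positivity
    calc ‖w s y‖ ≤ K * (-s) / (‖y‖ + Real.sqrt (-s)) ^ 3 := hwb s (hneg s hs) y
      _ ≤ |K * (-s)| / (‖y‖ + c₀) ^ 3 := div_norm_add_pow_le hc₀ (hsqrt s hs) 3 y
      _ ≤ Aw / (‖y‖ + c₀) ^ 3 := by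
          apply div_le_div_of_nonneg_right _ (by positivity)
          rw [abs_mul, abs_of_pos (by linarith [hneg s hs] : (0 : ℝ) < -s), hAw]
          exact mul_le_mul_of_nonneg_left (by linarith [hs.1]) (abs_nonneg _)
      _ = Aw * ((‖y‖ + c₀) ^ 3)⁻¹ := div_eq_mul_inv _ _
  have hdb' : ∀ s ∈ Ioo (2 * t) (t / 2), ∀ y : EuclideanSpace ℝ (Fin 3),
      ‖dw s y‖ ≤ |L| * ((‖y‖ + c₀) ^ 3)⁻¹ := by
    intro s hs y
    calc ‖dw s y‖ ≤ L / (‖y‖ + Real.sqrt (-s)) ^ 3 := hdb s (hneg s hs) y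
      _ ≤ |L| / (‖y‖ + c₀) ^ 3 := div_norm_add_pow_le hc₀ (hsqrt s hs) 3 y
      _ = |L| * ((‖y‖ + c₀) ^ 3)⁻¹ := div_eq_mul_inv _ _
  -- measurability of the integrands
  have hΓm : AEStronglyMeasurable (fun p : (EuclideanSpace ℝ (Fin 3)) × (EuclideanSpace ℝ (Fin 3)) =>
      newtonKernel (p.1 - p.2)) ((volume : Measure (EuclideanSpace ℝ (Fin 3))).prod volume) :=
    (measurable_newtonKernel.comp (measurable_fst.sub measurable_snd)).aestronglyMeasurable
  have hmeasF : ∀ s < 0, AEStronglyMeasurable (fun p : (EuclideanSpace ℝ (Fin 3)) ×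
      (EuclideanSpace ℝ (Fin 3)) => newtonKernel (p.1 - p.2) * ⟪w s p.1, w s p.2⟫)
      ((volume : Measure (EuclideanSpace ℝ (Fin 3))).prod volume) := fun s hs =>
    hΓm.mul (((hsm.contDiff_slice hs).continuous.comp continuous_fst).inner
      ((hsm.contDiff_slice hs).continuous.comp continuous_snd)).aestronglyMeasurable
  have hcw : Continuous (w t) := (hsm.contDiff_slice ht).continuous
  have hcd : Continuous (dw t) := (hdsm.contDiff_slice ht).continuous
  have hmeasF' : AEStronglyMeasurable (fun p : (EuclideanSpace ℝ (Fin 3)) × (EuclideanSpace ℝ (Fin 3)) =>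
      newtonKernel (p.1 - p.2) * (⟪w t p.1, dw t p.2⟫ + ⟪dw t p.1, w t p.2⟫))
      ((volume : Measure (EuclideanSpace ℝ (Fin 3))).prod volume) :=
    hΓm.mul (((hcw.comp continuous_fst).inner (hcd.comp continuous_snd)).add
      ((hcd.comp continuous_fst).inner (hcw.comp continuous_snd))).aestronglyMeasurable
  -- integrability at `t`
  have htwin : t ∈ Ioo (2 * t) (t / 2) := ⟨by linarith, by linarith⟩
  have hFint : Integrable (fun p : (EuclideanSpace ℝ (Fin 3)) × (EuclideanSpace ℝ (Fin 3)) =>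
      newtonKernel (p.1 - p.2) * ⟪w t p.1, w t p.2⟫)
      ((volume : Measure (EuclideanSpace ℝ (Fin 3))).prod volume) :=
    integrable_newtonKernel_inner_prod hcw hcw hc₀ (hwb' t htwin) (hwb' t htwin)
  -- the dominant
  set bound : (EuclideanSpace ℝ (Fin 3)) × (EuclideanSpace ℝ (Fin 3)) → ℝ :=
    fun p => 2 * Aw * |L| * (|newtonKernel (p.1 - p.2)| *
      (((‖p.1‖ + c₀) ^ 3)⁻¹ * ((‖p.2‖ + c₀) ^ 3)⁻¹)) with hbound
  have hbound_int : Integrable bound ((volume : Measure (EuclideanSpace ℝ (Fin 3))).prod volume) :=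
    (integrable_newtonKernel_weight_prod hc₀).const_mul _
  have hbd : ∀ p : (EuclideanSpace ℝ (Fin 3)) × (EuclideanSpace ℝ (Fin 3)), ∀ s ∈ Ioo (2 * t) (t / 2),
      ‖newtonKernel (p.1 - p.2) * (⟪w s p.1, dw s p.2⟫ + ⟪dw s p.1, w s p.2⟫)‖ ≤ bound p := by
    intro p s hs
    have h1 : ‖⟪w s p.1, dw s p.2⟫‖ ≤ Aw * ((‖p.1‖ + c₀) ^ 3)⁻¹ * (|L| * ((‖p.2‖ + c₀) ^ 3)⁻¹) :=
      (norm_inner_le_norm _ _).trans (mul_le_mul (hwb' s hs _) (hdb' s hs _) (norm_nonneg _)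
        (by positivity))
    have h2 : ‖⟪dw s p.1, w s p.2⟫‖ ≤ |L| * ((‖p.1‖ + c₀) ^ 3)⁻¹ * (Aw * ((‖p.2‖ + c₀) ^ 3)⁻¹) :=
      (norm_inner_le_norm _ _).trans (mul_le_mul (hdb' s hs _) (hwb' s hs _) (norm_nonneg _)
        (by positivity))
    rw [norm_mul, Real.norm_eq_abs]
    calc |newtonKernel (p.1 - p.2)| * ‖⟪w s p.1, dw s p.2⟫ + ⟪dw s p.1, w s p.2⟫‖
        ≤ |newtonKernel (p.1 - p.2)| * (Aw * ((‖p.1‖ + c₀) ^ 3)⁻¹ * (|L| * ((‖p.2‖ + c₀) ^ 3)⁻¹) +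
            |L| * ((‖p.1‖ + c₀) ^ 3)⁻¹ * (Aw * ((‖p.2‖ + c₀) ^ 3)⁻¹)) :=
          mul_le_mul_of_nonneg_left ((norm_add_le _ _).trans (add_le_add h1 h2)) (abs_nonneg _)
      _ = bound p := by simp only [hbound]; ring
  -- pointwise differentiability in time
  have hdiff : ∀ p : (EuclideanSpace ℝ (Fin 3)) × (EuclideanSpace ℝ (Fin 3)), ∀ s ∈ Ioo (2 * t) (t / 2),
      HasDerivAt (fun s => newtonKernel (p.1 - p.2) * ⟪w s p.1, w s p.2⟫)
        (newtonKernel (p.1 - p.2) * (⟪w s p.1, dw s p.2⟫ + ⟪dw s p.1, w s p.2⟫)) s := by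
    intro p s hs
    exact ((hsm.hasDerivAt_timeLine isOpen_Iio (hneg s hs) p.1).inner ℝ
      (hsm.hasDerivAt_timeLine isOpen_Iio (hneg s hs) p.2)).const_mul _
  exact (hasDerivAt_integral_of_dominated_loc_of_deriv_le
    (μ := ((volume : Measure (EuclideanSpace ℝ (Fin 3))).prod volume))
    (F := fun s p => newtonKernel (p.1 - p.2) * ⟪w s p.1, w s p.2⟫)
    (F' := fun s p => newtonKernel (p.1 - p.2) * (⟪w s p.1, dw s p.2⟫ + ⟪dw s p.1, w s p.2⟫))
    (x₀ := t) hwin (Filter.eventually_of_mem hwin fun s hs => hmeasF s (hneg s hs)) hFint hmeasF'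
    (ae_of_all _ hbd) hbound_int (ae_of_all _ hdiff)).2

/-- **`d/dt ∫ ⟪w, Γ ⋆ w⟫ = 2 ∫ ⟪∂ₜw, Γ ⋆ w⟫`** for a jointly smooth `w` on `t < 0` with the apex
majorants (Fubini before and after differentiating, and the symmetry of the kernel). In the package,
`N(t) = -∫ ⟪w, Γ ⋆ w⟫` is the Coulomb energy and `N' = -2 ∫ ⟪∂ₜw, Γ ⋆ w⟫`. [folklore] -/
theorem hasDerivAt_integral_inner_newtonPotential
    {w : ℝ → (EuclideanSpace ℝ (Fin 3)) → (EuclideanSpace ℝ (Fin 3))} {K L : ℝ}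
    (hsm : IsSmoothSpaceTimeOn (Iio (0 : ℝ)) w)
    (hwb : ∀ s < 0, ∀ y : EuclideanSpace ℝ (Fin 3), ‖w s y‖ ≤ K * (-s) / (‖y‖ + Real.sqrt (-s)) ^ 3)
    (hdb : ∀ s < 0, ∀ y : EuclideanSpace ℝ (Fin 3),
      ‖deriv (fun τ => w τ y) s‖ ≤ L / (‖y‖ + Real.sqrt (-s)) ^ 3)
    {t : ℝ} (ht : t < 0) :
    HasDerivAt (fun s => ∫ x, ⟪w s x, ∫ y, newtonKernel (x - y) • w s y⟫)
      (2 * ∫ x, ⟪deriv (fun τ => w τ x) t, ∫ y, newtonKernel (x - y) • w t y⟫) t := by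
  have hD := hasDerivAt_coulomb_double_integral hsm hwb hdb ht
  have hdsm : IsSmoothSpaceTimeOn (Iio (0 : ℝ)) fun s x => deriv (fun τ => w τ x) s :=
    hsm.isSmoothSpaceTimeOn_deriv isOpen_Iio
  -- slice bounds in product form
  have hws : ∀ s < 0, ∀ y : EuclideanSpace ℝ (Fin 3),
      ‖w s y‖ ≤ K * (-s) * ((‖y‖ + Real.sqrt (-s)) ^ 3)⁻¹ := fun s hs y => by
    rw [← div_eq_mul_inv]; exact hwb s hs y
  have hds : ∀ s < 0, ∀ y : EuclideanSpace ℝ (Fin 3),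
      ‖deriv (fun τ => w τ y) s‖ ≤ L * ((‖y‖ + Real.sqrt (-s)) ^ 3)⁻¹ := fun s hs y => by
    rw [← div_eq_mul_inv]; exact hdb s hs y
  have ha : ∀ s < 0, 0 < Real.sqrt (-s) := fun s hs => Real.sqrt_pos.2 (by linarith)
  -- the double integral is the single integral, on the whole slab
  have heq : (fun s => ∫ x, ⟪w s x, ∫ y, newtonKernel (x - y) • w s y⟫) =ᶠ[𝓝 t]
      fun s => ∫ p, newtonKernel (p.1 - p.2) * ⟪w s p.1, w s p.2⟫
        ∂((volume : Measure (EuclideanSpace ℝ (Fin 3))).prod volume) := by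
    filter_upwards [Iio_mem_nhds ht] with s hs
    exact (integral_newtonKernel_inner_prod (hsm.contDiff_slice hs).continuous
      (hsm.contDiff_slice hs).continuous (ha s hs) (hws s hs) (hws s hs)).symm
  refine (hD.congr_of_eventuallyEq heq).congr_deriv ?_
  -- the derivative: split, Fubini, symmetry
  have hcw : Continuous (w t) := (hsm.contDiff_slice ht).continuous
  have hcd : Continuous fun x => deriv (fun τ => w τ x) t := (hdsm.contDiff_slice ht).continuous
  have hi1 := integrable_newtonKernel_inner_prod hcw hcd (ha t ht) (hws t ht) (hds t ht)
  have hi2 := integrable_newtonKernel_inner_prod hcd hcw (ha t ht) (hds t ht) (hws t ht)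
  simp_rw [mul_add]
  rw [integral_add hi1 hi2, integral_newtonKernel_inner_prod hcw hcd (ha t ht) (hws t ht) (hds t ht),
    integral_newtonKernel_inner_prod hcd hcw (ha t ht) (hds t ht) (hws t ht),
    integral_inner_newtonPotential_symm hcw hcd (ha t ht) (hws t ht) (hds t ht), two_mul]
  congr 1
  refine integral_congr_ae (Eventually.of_forall fun y => ?_)
  exact real_inner_comm _ _

/-! ## Registered sub-goal (helper stub of `stub_coulombEnergyPackage`) -/

/-- **Registered helper stub `stub_coulombEnergyDerivative`** (crux stmt-NavierStokesRegularity-11717,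
line `finite-energy-log-convexity`, helper of S4-E): differentiability in time of `∫ ⟪w, Γ ⋆ w⟫` for a
jointly smooth field with the apex majorants, as registered. [folklore] -/
theorem stub_coulombEnergyDerivative :
    ∀ (w : ℝ → EuclideanSpace ℝ (Fin 3) → EuclideanSpace ℝ (Fin 3)) (K L t : ℝ),
      IsSmoothSpaceTimeOn (Iio (0 : ℝ)) w →
      (∀ s < 0, ∀ y : EuclideanSpace ℝ (Fin 3), ‖w s y‖ ≤ K * (-s) / (‖y‖ + Real.sqrt (-s)) ^ 3) →
      (∀ s < 0, ∀ y : EuclideanSpace ℝ (Fin 3),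
        ‖deriv (fun τ => w τ y) s‖ ≤ L / (‖y‖ + Real.sqrt (-s)) ^ 3) →
      t < 0 →
      HasDerivAt (fun s => ∫ x, ⟪w s x, ∫ y, newtonKernel (x - y) • w s y⟫)
        (2 * ∫ x, ⟪deriv (fun τ => w τ x) t, ∫ y, newtonKernel (x - y) • w t y⟫) t :=
  fun _w _K _L _t hsm hwb hdb ht => hasDerivAt_integral_inner_newtonPotential hsm hwb hdb ht

end Summit.NavierStokesRegularity.NavierStokesRegularity.Theorems.RellichScarScarRigidity

end
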